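import Literature.Geometry.Hyperkaehler.IsotropyGroupInvariance
import Literature.Geometry.Hyperkaehler.InvariantTwoFormsTwistorPrimitive
import Mathlib.LinearAlgebra.Multilinear.Basis
import Mathlib.Topology.Algebra.Module.FiniteDimension
import HarnessLib

/-!
# No covector of degree `0 < k < dim` is invariant under every complex structure: the torus case of
# "Mumford–Tate generic ⟺ no non-trivial integer `(p,p)`-cycles" (Verbitsky 2008, §4 Rem. 4.3), pointwise

Topic `Literature/Geometry/Hyperkaehler`, namespace `Literature.Geometry.Hyperkaehler.AllComplexStructures`. Written by
the literature seat `lit-w-verbitsky` (gen 11) of the cell `pub-hsemireg` (HodgeConjecture venture), 2026-08-24, as a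
kernel leg of rows V-V9 / V-V10 (generic induced complex structures; Mumford–Tate generic tori) of that cell's Verbitsky
table. THEOREMS ONLY (no definition, no named fact, no `sorry`).

## Source, verbatim (M. Verbitsky, *Coherent sheaves on general K3 surfaces and tori*, Pure Appl. Math. Q. 4 (2008)
no. 3, 651–714, §4 "Generic complex structures on hyperkähler manifolds", AS PRINTED; printed page = PDF page + 650,
page/line = the text layer of the publisher's PDF)

* p.667 L31–34: "Given a complex structure `I` on `M`, let `I : Hⁱ(M) → Hⁱ(M)` be the operator mapping a `(p,q)`-class
  `η` to `√−1 (p − q)η`. This gives a `U(1)`-action `u_I` on `Hⁱ(M)`. **Remark 4.1:** Clearly, a form is of type `(p,p)`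
  with respect to `I` if and only if it is `u_I`-invariant."
* p.668 L3–10: "Let `𝔤₀ ⊂ End(H^*(M))` be the Lie algebra generated by `u_I`, for all complex structures `I` which are
  compatible with some hyperkähler structure on `M`. […] By Remark 4.1, a cohomology class `η` is `𝔤₀`-invariant if and
  only if `η` is invariant with respect to all complex structures `I` induced by some hyperkähler structure."
* p.668 L19–22, **Definition 4.2:** "Let `M` be a compact manifold of hyperkähler type, and `I` a complex structure
  which is compatible with some hyperkähler structure. Consider the Lie algebra `𝔤₀ ⊂ End(H^*(M))` defined above. Assume
  that all integer `(p,p)`-classes on `(M, I)` are `𝔤₀`-invariant. Then `I` is called Mumford–Tate generic."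
* p.668 L23–24, **Remark 4.3:** "When `M` is a K3 surface or a torus, `M` is Mumford–Tate generic if and only if `M`
  does not have non-trivial integer `(p,p)`-cycles."
* For the torus half of Remark 4.3 one also needs that on a torus EVERY complex structure is "compatible with some
  hyperkähler structure": N. Buskin, E. Izadi, *Twistor lines in the period domain of complex tori*, arXiv:1806.07831v2,
  §1.2 (p.5 L46–p.6 L4: "Let `J` be a complex structure that anti-commutes with `I`. Then `V_ℝ` splits, in a non-unique
  way, as a direct sum of 4-dimensional subspaces of the form `⟨v, Iv, Jv, IJv⟩` …") and **Prop. 1.2** (p.6 L29–34: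
  "Given a triple of complex structures `(I, J, K)` on `A` satisfying the quaternionic identities, there exist a
  (non-unique) metric `g` on `A` such that `(I, J, K)` is a hyperkähler structure with respect to `g`.").

## What the torus case of Remark 4.3 comes to, and what is formalised

For a compact complex torus `T = V_ℝ/Λ` of complex dimension `2n`, `H^k(T, ℝ) = Λ^k V_ℝ^*` (constant forms), every
complex structure `I` on `V_ℝ` is induced by a hyperkähler structure (Buskin–Izadi §1.2 + Prop. 1.2; not formalised
here), and a `u_I`-invariant class is in particular fixed by the element `u_I(π/2)`, i.e. by the pull-back `I^*`
(the tree's `IsotropyGroupInvariance.lean`, §1: `ad I β = 0` integrates to invariance under the circle `cos θ + sin θ I`,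
`compContinuousLinearMap_eq_self_of_adAlt_eq_zero`). So "`η` is `𝔤₀`-invariant" implies "`η` is fixed by `I^*` for
EVERY complex structure `I` on `V_ℝ`", and Remark 4.3 for tori says that in degrees `0 < k < 4n` only `η = 0` is:
then "all integer `(p,p)`-classes are `𝔤₀`-invariant" is "there are no non-zero integer `(p,p)`-classes" (in degrees
strictly between `0` and `4n`). The finite-dimensional statement proved here, for ANY even-dimensional real space:

* §1 `exists_complexStructure_pair`: for a real basis `(r_s)` indexed by `Bool × ι` and indices `p ≠ q`, two complex
  structures `L, L'` (`L² = L'² = −1`) with `L r_p = r_q`, `L' r_p = −r_q` that agree on all other basis vectors (they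
  pair `p ↔ q`, the two partners `(¬p₁, p₂) ↔ (¬q₁, q₂)` when these are new indices, and are the standard structure
  `r_(ff,a) ↦ r_(tt,a) ↦ −r_(ff,a)` on the untouched blocks).
* §2 **`eq_zero_of_forall_complexStructure_invariant`**: `dim_ℝ F = 2m`, `0 < k < 2m`, `β ∈ Alt^k(F; W)` with
  `L^*β = β` for every `L` with `L² = −1` ⟹ `β = 0` (every basis coefficient `β(r_{s₀}, …, r_{s_{k−1}})` equals its own
  negative: compare `L^*` and `L'^*` of §1 on the pair `(s₀, q)` with `q` off the tuple — possible exactly because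
  `k < dim`); the infinitesimal form **`eq_zero_of_forall_adAlt_eq_zero`** (`ad L β = 0` for every complex structure
  `L` ⟹ `β = 0`, via the tree's integration lemma) — this is "`𝔤₀`-invariant ⟹ `0`" at the level of constant forms;
  and the complex-carrier reading `eq_zero_of_forall_complexStructure_invariant_complex` (`E` a complex space,
  `0 < k < 2 dim_ℂ E`, all complex structures of the underlying REAL space); contrapositive
  `exists_complexStructure_compContinuousLinearMap_ne` (a non-zero `η` is moved by some complex structure: the locus
  `C_η` of p.668 L11–16 is proper).
* §3 sharpness of `k < dim`: a top-degree form IS fixed by every complex structure (`det L = 1`, the tree's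
  `det_eq_one_of_comp_self_eq_neg_id`): `compContinuousLinearMap_eq_self_of_finrank_eq` (real-valued top forms).

## Scope (faithfulness)

(i) Pointwise / constant forms only; no torus, lattice, integrality or Hodge decomposition is used — the theorem is the
linear algebra that makes Remark 4.3 true for tori, under the hypothesis "fixed by `I^*` for all complex structures
`I`", which `𝔤₀`-invariance implies (Rem. 4.1 and the integration lemma); the K3 half of Remark 4.3 (where
`𝔤₀ ≅ 𝔰𝔬(H², q)`, p.668 L4–8) is NOT here. (ii) "All complex structures" of the real space, not "all induced complex
structures of ONE hyperkähler structure" (for those the invariants are the `SU(2)`-invariant forms, which are far from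
zero — `InvariantTwoFormsTwistorPrimitive.lean`, `GenericInducedComplexStructure.lean`); that every complex structure of a
`4n`-dimensional real space is hyperkähler-compatible (Buskin–Izadi §1.2, Prop. 1.2) is quoted, not formalised.
(iii) Definition 4.2, Claim 4.4 and Theorem 4.5 are not formalised.

## References

* [Verbitsky2008CoherentSheavesK3Tori] M. Verbitsky, *Coherent sheaves on general K3 surfaces and tori*, Pure Appl.
  Math. Q. 4 (2008) 651–714, §4: p.667 L31–34 (the `U(1)`-action `u_I`, Rem. 4.1), p.668 L3–10 (`𝔤₀`), Def. 4.2
  (p.668 L19–22), Rem. 4.3 (p.668 L23–24) — read on the publisher's PDF.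
* [BuskinIzadi2020TwistorLinesTori] N. Buskin, E. Izadi, *Twistor lines in the period domain of complex tori*, Geom.
  Dedicata 213 (2021) 21–47 = arXiv:1806.07831v2, §1.2 (p.5 L46–p.6 L28) and Prop. 1.2 (p.6 L29–34) — read on the
  arXiv v2 PDF.
* [Verbitsky1996Hyperholomorphic] M. Verbitsky, J. Alg. Geom. 5 (1996) = alg-geom/9307008, §1 Prop. 1.1–1.2 (the
  integration `𝔰𝔲(2) ↝ SU(2)` behind `IsotropyGroupInvariance.lean`).
-/

noncomputable section

open Module Literature.LinearAlgebra.Alternating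

namespace Literature.Geometry.Hyperkaehler.AllComplexStructures

variable {F W : Type*} [NormedAddCommGroup F] [NormedSpace ℝ F] [NormedAddCommGroup W] [NormedSpace ℝ W]

/-! ### §1 Two complex structures that differ on exactly one basis pair -/

section Pair

variable {ι : Type*} [DecidableEq ι]

omit [DecidableEq ι] in
/-- The partner index `(b, a) ↦ (¬b, a)` has no fixed point. [folklore] -/
private theorem partner_ne (s : Bool × ι) : ((!s.1, s.2) : Bool × ι) ≠ s := by
  intro h
  have := congrArg Prod.fst h
  exact Bool.not_ne_self _ this

omit [DecidableEq ι] in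
/-- The partner index is an involution. [folklore] -/
private theorem partner_partner (s : Bool × ι) : ((!!s.1, s.2) : Bool × ι) = s := by
  obtain ⟨b, a⟩ := s
  simp

/-- **Two complex structures differing on one basis pair.** For a real basis `r` indexed by `Bool × ι` and two distinct
indices `p ≠ q` there are complex structures `L, L'` (`L² = L'² = −1`) with `L(r_p) = r_q`, `L'(r_p) = −r_q`, which
AGREE on every other basis vector `r_s`, `s ∉ {p, q}` (both pair `p` with `q`, the partners of `p` and `q` with each
other when these are two further indices, and act as the standard structure `r_(ff,a) ↦ r_(tt,a) ↦ −r_(ff,a)` on the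
remaining blocks). [cite: BuskinIzadi2020TwistorLinesTori, §1.2 (p.5 L46–p.6 L28: block bases `⟨v, Iv, Jv, IJv⟩` on
which `J` is block-diagonal) — the construction pattern; the statement itself is folklore linear algebra] -/
theorem exists_complexStructure_pair [FiniteDimensional ℝ F] (r : Basis (Bool × ι) ℝ F) {p q : Bool × ι}
    (hpq : p ≠ q) :
    ∃ L L' : F →L[ℝ] F, (∀ v, L (L v) = -v) ∧ (∀ v, L' (L' v) = -v) ∧
      L (r p) = r q ∧ L' (r p) = -r q ∧ ∀ s, s ≠ p → s ≠ q → L (r s) = L' (r s) := by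
  classical
  -- the images of the basis vectors, as a function of the sign `ε = ±1` on the pair `{p, q}`
  let f : ℝ → Bool × ι → F := fun ε s ↦
    if s = p then ε • r q else if s = q then -(ε • r p)
    else if s = ((!p.1, p.2) : Bool × ι) then r ((!q.1, q.2) : Bool × ι)
    else if s = ((!q.1, q.2) : Bool × ι) then -r ((!p.1, p.2) : Bool × ι)
    else if s.1 = true then -r ((!s.1, s.2) : Bool × ι) else r ((!s.1, s.2) : Bool × ι)
  have hf_p : ∀ ε, f ε p = ε • r q := fun ε ↦ by simp only [f, if_pos rfl]
  have hf_q : ∀ ε, f ε q = -(ε • r p) := fun ε ↦ by simp only [f, if_neg hpq.symm, if_true]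
  have hf_σp : ∀ ε, ((!p.1, p.2) : Bool × ι) ≠ q → f ε (!p.1, p.2) = r (!q.1, q.2) := fun ε h ↦ by
    simp only [f, if_neg (partner_ne p), if_neg h, if_true]
  have hσpq_of : ((!q.1, q.2) : Bool × ι) = ((!p.1, p.2) : Bool × ι) → q = p := fun h' ↦ by
    have := congrArg (fun s : Bool × ι ↦ ((!s.1, s.2) : Bool × ι)) h'
    simpa only [partner_partner] using this
  have hf_σq : ∀ ε, ((!q.1, q.2) : Bool × ι) ≠ p → f ε (!q.1, q.2) = -r (!p.1, p.2) := fun ε h ↦ by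
    have h2 : ((!q.1, q.2) : Bool × ι) ≠ ((!p.1, p.2) : Bool × ι) := fun h' ↦ hpq (hσpq_of h').symm
    simp only [f, if_neg h, if_neg (partner_ne q), if_neg h2, if_true]
  have hf_other : ∀ ε s, s ≠ p → s ≠ q → s ≠ ((!p.1, p.2) : Bool × ι) → s ≠ ((!q.1, q.2) : Bool × ι) →
      f ε s = if s.1 = true then -r ((!s.1, s.2) : Bool × ι) else r ((!s.1, s.2) : Bool × ι) :=
    fun ε s h1 h2 h3 h4 ↦ by simp only [f, if_neg h1, if_neg h2, if_neg h3, if_neg h4]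
  -- the linear maps
  let L : ℝ → (F →L[ℝ] F) := fun ε ↦ LinearMap.toContinuousLinearMap (r.constr ℝ (f ε))
  have hL : ∀ ε s, L ε (r s) = f ε s := fun ε s ↦ by
    simp only [L, LinearMap.coe_toContinuousLinearMap', Basis.constr_basis]
  -- `L ε` squares to `−1` on the basis when `ε² = 1`
  have hsq : ∀ ε, ε * ε = 1 → ∀ s, L ε (L ε (r s)) = -r s := by
    intro ε hε s
    by_cases h1 : s = p
    · subst h1
      rw [hL, hf_p, map_smul, hL, hf_q, smul_neg, smul_smul, hε, one_smul]
    by_cases h2 : s = q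
    · subst h2
      rw [hL, hf_q, map_neg, map_smul, hL, hf_p, smul_smul, hε, one_smul]
    by_cases h3 : s = ((!p.1, p.2) : Bool × ι)
    · subst h3
      have hσpq : ((!p.1, p.2) : Bool × ι) ≠ q := h2
      have hσqp : ((!q.1, q.2) : Bool × ι) ≠ p := by
        intro h'
        apply h2
        rw [← h']
        exact partner_partner q
      rw [hL, hf_σp ε hσpq, hL, hf_σq ε hσqp]
    by_cases h4 : s = ((!q.1, q.2) : Bool × ι)
    · subst h4
      have hσqp : ((!q.1, q.2) : Bool × ι) ≠ p := h1
      have hσpq : ((!p.1, p.2) : Bool × ι) ≠ q := by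
        intro h'
        apply h1
        rw [← h']
        exact partner_partner p
      rw [hL, hf_σq ε hσqp, map_neg, hL, hf_σp ε hσpq]
    -- the remaining blocks carry the standard structure
    have h1' : ((!s.1, s.2) : Bool × ι) ≠ p := by
      intro h'; apply h3; rw [← h']; exact (partner_partner s).symm
    have h2' : ((!s.1, s.2) : Bool × ι) ≠ q := by
      intro h'; apply h4; rw [← h']; exact (partner_partner s).symm
    have h3' : ((!s.1, s.2) : Bool × ι) ≠ ((!p.1, p.2) : Bool × ι) := by
      intro h'; apply h1
      have := congrArg (fun t : Bool × ι ↦ ((!t.1, t.2) : Bool × ι)) h'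
      simpa only [partner_partner] using this
    have h4' : ((!s.1, s.2) : Bool × ι) ≠ ((!q.1, q.2) : Bool × ι) := by
      intro h'; apply h2
      have := congrArg (fun t : Bool × ι ↦ ((!t.1, t.2) : Bool × ι)) h'
      simpa only [partner_partner] using this
    rw [hL, hf_other ε s h1 h2 h3 h4]
    by_cases hb : s.1 = true
    · have hs' : ((true, s.2) : Bool × ι) = s := Prod.ext hb.symm rfl
      have hns : (!s.1) = false := by rw [hb]; rfl
      rw [if_pos hb, map_neg, hL, hf_other ε _ h1' h2' h3' h4']
      simp only [hns, Bool.false_eq_true, if_false, Bool.not_false, hs']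
    · have hb' : s.1 = false := by simpa using hb
      have hs' : ((false, s.2) : Bool × ι) = s := Prod.ext hb'.symm rfl
      have hns : (!s.1) = true := by rw [hb']; rfl
      rw [if_neg hb, hL, hf_other ε _ h1' h2' h3' h4']
      simp only [hns, if_true, Bool.not_true, hs']
  -- from the basis to all vectors
  have hsq' : ∀ ε, ε * ε = 1 → ∀ v, L ε (L ε v) = -v := by
    intro ε hε v
    have key : ((L ε : F →ₗ[ℝ] F) ∘ₗ (L ε : F →ₗ[ℝ] F)) = -LinearMap.id :=
      r.ext fun s ↦ by simpa using hsq ε hε s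
    simpa using LinearMap.congr_fun key v
  refine ⟨L 1, L (-1), hsq' 1 (by norm_num), hsq' (-1) (by norm_num), ?_, ?_, ?_⟩
  · rw [hL, hf_p, one_smul]
  · rw [hL, hf_p, neg_one_smul]
  · intro s h1 h2
    rw [hL, hL]
    by_cases h3 : s = ((!p.1, p.2) : Bool × ι)
    · by_cases h : ((!p.1, p.2) : Bool × ι) = q
      · exact absurd (h3.trans h) h2
      · rw [h3, hf_σp 1 h, hf_σp (-1) h]
    by_cases h4 : s = ((!q.1, q.2) : Bool × ι)
    · by_cases h : ((!q.1, q.2) : Bool × ι) = p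
      · exact absurd (h4.trans h) h1
      · rw [h4, hf_σq 1 h, hf_σq (-1) h]
    rw [hf_other 1 s h1 h2 h3 h4, hf_other (-1) s h1 h2 h3 h4]

end Pair

/-! ### §2 The vanishing theorem -/

/-- **A `k`-covector with `0 < k < dim F` that is fixed by EVERY complex structure of the even-dimensional real space
`F` vanishes** — the linear algebra of the torus half of Remark 4.3: a constant form on a torus invariant under `u_I`
for all complex structures `I` (in particular under each `I^*`) is zero in degrees `0 < k < dim`. (Each basis coefficient
`β(r_{s₀}, …, r_{s_{k−1}})` with distinct indices is compared through the two structures of §1 built on the pair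
`(s₀, q)`, `q` an index not among the `s_t`: they send the tuple to the same tuple up to the sign of the first entry,
so the coefficient equals its own negative.)
[cite: Verbitsky2008CoherentSheavesK3Tori, §4 Rem. 4.3 (p.668 L23–24) with Rem. 4.1 (p.667 L33–34) and the definition
of 𝔤₀ (p.668 L3–10)] -/
theorem eq_zero_of_forall_complexStructure_invariant [FiniteDimensional ℝ F] {m k : ℕ} (hF : finrank ℝ F = 2 * m)
    (hk : 0 < k) (hkm : k < 2 * m) (β : F [⋀^Fin k]→L[ℝ] W)
    (hβ : ∀ L : F →L[ℝ] F, (∀ v, L (L v) = -v) → β.compContinuousLinearMap L = β) : β = 0 := by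
  classical
  -- a real basis indexed by `Bool × Fin m`
  have hcard : Fintype.card (Bool × Fin m) = finrank ℝ F := by
    rw [Fintype.card_prod, Fintype.card_bool, Fintype.card_fin, hF]
  let r : Basis (Bool × Fin m) ℝ F :=
    (finBasisOfFinrankEq ℝ F hcard.symm).reindex (Fintype.equivOfCardEq (by rw [Fintype.card_fin]))
  -- every basis coefficient vanishes
  have hcoef : ∀ s : Fin k → Bool × Fin m, β (fun t ↦ r (s t)) = 0 := by
    intro s
    by_cases hs : Function.Injective s
    · -- an index not hit by `s` (`k < 2m`)
      have hns : ¬Function.Surjective s := fun hsurj ↦ by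
        have := Fintype.card_le_of_surjective s hsurj
        rw [Fintype.card_prod, Fintype.card_bool, Fintype.card_fin, Fintype.card_fin] at this
        omega
      obtain ⟨q, hq⟩ := not_forall.mp hns
      set p := s ⟨0, hk⟩ with hp
      have hpq : p ≠ q := fun h ↦ hq ⟨⟨0, hk⟩, by rw [← hp]; exact h⟩
      obtain ⟨L, L', hLL, hL'L', hLp, hL'p, hagree⟩ := exists_complexStructure_pair r hpq
      -- the two image tuples differ only in the sign of slot `0`
      have himg : (fun t ↦ L (r (s t))) = Function.update (fun t ↦ L' (r (s t))) ⟨0, hk⟩ (r q) := by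
        funext t
        by_cases ht : t = ⟨0, hk⟩
        · subst ht
          rw [Function.update_self, ← hp, hLp]
        · rw [Function.update_of_ne ht]
          have h1 : s t ≠ p := fun h ↦ ht (hs (h.trans hp))
          have h2 : s t ≠ q := fun h ↦ hq ⟨t, h⟩
          exact hagree (s t) h1 h2
      have himg' : (fun t ↦ L' (r (s t))) =
          Function.update (fun t ↦ L' (r (s t))) ⟨0, hk⟩ ((-1 : ℝ) • r q) := by
        funext t
        by_cases ht : t = ⟨0, hk⟩
        · subst ht
          rw [Function.update_self, ← hp, hL'p, neg_one_smul]
        · rw [Function.update_of_ne ht]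
      have e1 : β (fun t ↦ r (s t)) = β (fun t ↦ L (r (s t))) := by
        conv_lhs => rw [← hβ L hLL]
        rfl
      have e2 : β (fun t ↦ r (s t)) = β (fun t ↦ L' (r (s t))) := by
        conv_lhs => rw [← hβ L' hL'L']
        rfl
      rw [himg] at e1
      rw [himg', ContinuousAlternatingMap.map_update_smul, neg_one_smul] at e2
      have hself : β (fun t ↦ r (s t)) = -β (fun t ↦ r (s t)) := e2.trans (by rw [← e1])
      have h2 : (2 : ℝ) • β (fun t ↦ r (s t)) = 0 := by
        rw [two_smul]
        nth_rw 2 [hself]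
        exact add_neg_cancel _
      exact (smul_eq_zero.mp h2).resolve_left two_ne_zero
    · exact β.map_eq_zero_of_not_injective _ fun h ↦ hs (Function.Injective.of_comp h)
  -- a multilinear map vanishing on all basis tuples vanishes
  have h0 : β.toContinuousMultilinearMap.toMultilinearMap =
      (0 : F [⋀^Fin k]→L[ℝ] W).toContinuousMultilinearMap.toMultilinearMap :=
    Basis.ext_multilinear (fun _ ↦ r) fun s ↦ by simpa using hcoef s
  ext v
  have := congrArg (fun g : MultilinearMap ℝ (fun _ : Fin k ↦ F) W ↦ g v) h0
  simpa using this

/-- **Infinitesimal form** ("`𝔤₀`-invariant ⟹ `0`" for constant forms on a torus, degrees `0 < k < dim`): if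
`ad L β = 0` for every complex structure `L` of the even-dimensional real space `F` (`u_L`-invariance, Rem. 4.1), then
`β = 0` for `0 < k < dim F` — `ad L β = 0` integrates to `L^*β = β` (`IsotropyGroupInvariance.lean`).
[cite: Verbitsky2008CoherentSheavesK3Tori, §4 Rem. 4.3 (p.668 L23–24) with p.668 L9–10 ("η is 𝔤₀-invariant if and
only if η is invariant with respect to all complex structures I induced by some hyperkähler structure")] -/
theorem eq_zero_of_forall_adAlt_eq_zero [FiniteDimensional ℝ F] {m k : ℕ} (hF : finrank ℝ F = 2 * m)
    (hk : 0 < k) (hkm : k < 2 * m) (β : F [⋀^Fin k]→L[ℝ] W)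
    (hβ : ∀ L : F →L[ℝ] F, (∀ v, L (L v) = -v) → adAlt L β = 0) : β = 0 :=
  eq_zero_of_forall_complexStructure_invariant hF hk hkm β fun L hL ↦
    compContinuousLinearMap_eq_self_of_adAlt_eq_zero hL (hβ L hL)

/-- **Complex-carrier reading** (the tree's convention for a complex torus `X = E/Λ`: `E` a finite-dimensional complex
space, `H^k(X, ·) =` constant `k`-forms on the underlying real space): for `0 < k < 2 dim_ℂ E = dim_ℝ E`, a constant
`k`-form fixed by every complex structure of the underlying REAL space of `E` is zero.
[cite: Verbitsky2008CoherentSheavesK3Tori, §4 Rem. 4.3 (p.668 L23–24), torus case] -/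
theorem eq_zero_of_forall_complexStructure_invariant_complex {E : Type*} [NormedAddCommGroup E] [NormedSpace ℂ E]
    [FiniteDimensional ℂ E] {k : ℕ} (hk : 0 < k) (hkE : k < 2 * finrank ℂ E) (β : E [⋀^Fin k]→L[ℝ] W)
    (hβ : ∀ L : E →L[ℝ] E, (∀ v, L (L v) = -v) → β.compContinuousLinearMap L = β) : β = 0 :=
  eq_zero_of_forall_complexStructure_invariant (finrank_real_of_complex E) hk hkE β hβ

/-- **Every non-zero `k`-covector (`0 < k < dim`) is moved by some complex structure**: the locus `C_η` of complex
structures fixing a given non-zero constant form `η` is a proper subset ("`C_η` is a closed complex analytic subset …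
of positive codimension" — here only: not everything). Contrapositive of the vanishing theorem.
[cite: Verbitsky2008CoherentSheavesK3Tori, §4 p.668 L11–16 with Rem. 4.3 (torus case)] -/
theorem exists_complexStructure_compContinuousLinearMap_ne [FiniteDimensional ℝ F] {m k : ℕ} (hF : finrank ℝ F = 2 * m)
    (hk : 0 < k) (hkm : k < 2 * m) {β : F [⋀^Fin k]→L[ℝ] W} (hβ : β ≠ 0) :
    ∃ L : F →L[ℝ] F, (∀ v, L (L v) = -v) ∧ β.compContinuousLinearMap L ≠ β := by
  by_contra h
  simp only [not_exists, not_and, not_not] at h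
  exact hβ (eq_zero_of_forall_complexStructure_invariant hF hk hkm β h)

/-! ### §3 Sharpness of `k < dim`: top-degree forms are fixed by every complex structure -/

/-- **Top degree is invariant:** a complex structure has determinant `1` (the tree's `det_eq_one_of_comp_self_eq_neg_id`),
so every top-degree real form is fixed by it — the bound `k < dim` in the vanishing theorem cannot be dropped (and
degree `0` is trivially invariant): on a torus, `H⁰` and `H^{top}` are the "trivial" integer `(p,p)`-cycles of
Remark 4.3. [cite: Verbitsky2008CoherentSheavesK3Tori, §4 Rem. 4.3 (p.668 L23–24: "non-trivial integer (p,p)-cycles")] -/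
theorem compContinuousLinearMap_eq_self_of_finrank_eq [FiniteDimensional ℝ F] {N : ℕ} (hF : finrank ℝ F = N)
    (θ : F [⋀^Fin N]→L[ℝ] ℝ) {L : F →L[ℝ] F} (hL : ∀ v, L (L v) = -v) : θ.compContinuousLinearMap L = θ := by
  set B := finBasisOfFinrankEq ℝ F hF
  have hθ := AlternatingMap.eq_smul_basis_det B θ.toAlternatingMap
  have hdet : LinearMap.det (L : F →ₗ[ℝ] F) = 1 :=
    det_eq_one_of_comp_self_eq_neg_id _ (by ext v; simp [hL])
  ext v
  rw [ContinuousAlternatingMap.compContinuousLinearMap_apply]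
  have e1 : θ (⇑L ∘ v) = θ.toAlternatingMap (⇑(L : F →ₗ[ℝ] F) ∘ v) := rfl
  have e2 : θ v = θ.toAlternatingMap v := rfl
  rw [e1, e2, hθ, AlternatingMap.smul_apply, AlternatingMap.smul_apply, B.det_comp, hdet, one_mul]

end Literature.Geometry.Hyperkaehler.AllComplexStructures
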